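import Summits.CriticalPhenomena.PercolationContinuityZ3.Theorems.PercExchangeRateTransportCriticalCurveRegular
import Summits.CriticalPhenomena.PercolationContinuityZ3.Theorems.PercExchangeRateTransportModelFacts

/-!
# ON-PATH LEMMA (F4) for the rung `IsoShelfNull` — line `iso_shelf_null`
# (crux K⁻ `SubcritExchangeUniformity`, stmt-CriticalPhenomena-16062; route `PercExchangeRateTransport`)

`isoShelfNull_of_percolationContinuityZ3 : PercolationContinuityZ3 → IsoShelfNull` (sorry-free; tagged
`aesop safe forward` — NOT `safe apply`, kernel-gap-7): the sub-problem statement `θ_{ℤ³}(p_c) = 0` implies the rung.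
Proof: the floor conjunct is the seed `CriticalCurveRegular_proof`; for `t < p₃ = p_c(ℤ³)`,
`0 ≤ θ(p₃,t) ≤ θ(p₃,p₃)` (`Locmod.theta_mono`, monotonicity in the vertical density) and
`θ(p₃,p₃) = θ_{ℤ³}(p_c(ℤ³))` (`ModelFacts` clause (9), the diagonal of the family is isotropic bond percolation),
which is `0` under the statement.  This is the S ⇒ Rung direction the forward tribunal's `on_path` reads (engine
mode, full tier: on_path = true); the other end of the rung is pinned to the PROVED floor by
`Lines/iso_shelf_null_special.lean` (`ShelfNullBelow ∅`).  The rung is a consequence of S that is NOT a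
consequence of the floor (kernel `floor_implies_rung` does not close; probe `floor → Rung` fails) and does NOT give
S back (probe `Rung → S` fails; kernel t1b `c_implies_s` not closed).
Self-contained: verbatim copies of the `def`s of `Lines/iso_shelf_null.lean` in the namespace `…IsoShelf.OnPath`.
-/

namespace Summit.CriticalPhenomena.PercolationContinuityZ3.Cruxes.SubcritExchangeUniformity.IsoShelf.OnPath

open Summit.CriticalPhenomena.PercolationContinuityZ3.Theses.PercExchangeRateTransport

/-- Verbatim copy of `IsoShelf.ShelfNullBelow`. -/
def ShelfNullBelow (T : Set ℝ) : Prop :=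
  let μ := Literature.Probability.Percolation.labelMeasure (Literature.Probability.LatticeModels.Site 3); let vert : Sym2 (Literature.Probability.LatticeModels.Site 3) → Prop := fun e => ∃ x : Literature.Probability.LatticeModels.Site 3, e = s(x, x + Pi.single (2 : Fin 3) 1); let cfg : ℝ → ℝ → (Sym2 (Literature.Probability.LatticeModels.Site 3) → ℝ) → Set (Sym2 (Literature.Probability.LatticeModels.Site 3)) := fun p t U => {e | e ∈ (Literature.Probability.LatticeModels.zdGraph 3).edgeSet ∧ ((vert e ∧ U e ≤ t) ∨ (¬ vert e ∧ U e ≤ p))}; let θ : ℝ → ℝ → ℝ := fun p t => μ.real {U | cfg p t U ∈ Literature.Probability.Percolation.percolatesAt (0 : Literature.Probability.LatticeModels.Site 3)}; let pc : ℝ → ℝ := fun t => sInf ({p : ℝ | 0 ≤ p ∧ p ≤ 1 ∧ 0 < θ p t} ∪ {1}); (ContinuousOn pc (Set.Ioo 0 1) ∧ ∀ t ∈ Set.Ioo (0 : ℝ) 1, 0 < pc t ∧ pc t < 1) ∧ ∀ t ∈ T, t ∈ Set.Ioo (0 : ℝ) 1 → t < Literature.Probability.Percolation.criticalProb (Literature.Probability.LatticeModels.zdGraph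 3) (0 : Literature.Probability.LatticeModels.Site 3) → θ (Literature.Probability.Percolation.criticalProb (Literature.Probability.LatticeModels.zdGraph 3) (0 : Literature.Probability.LatticeModels.Site 3)) t = 0

/-- Verbatim copy of `IsoShelf.IsoShelfNull`: the rung, `T = univ`. -/
def IsoShelfNull : Prop := ShelfNullBelow Set.univ

/-- The rung contains the floor. -/
@[aesop safe forward] theorem criticalCurveRegular_of_isoShelfNull : IsoShelfNull → CriticalCurveRegular := by
  unfold IsoShelfNull ShelfNullBelow CriticalCurveRegular
  exact fun h => h.1

/-- **ON-PATH LEMMA (F4).** `PercolationContinuityZ3` implies the rung: the floor conjunct is the seed;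
for `t < p₃`, `0 ≤ θ(p₃,t) ≤ θ(p₃,p₃) = θ_{ℤ³}(p_c(ℤ³)) = 0` (`Locmod.theta_mono`, `ModelFacts` clause (9)). -/
@[aesop safe forward] theorem isoShelfNull_of_percolationContinuityZ3
    (hS : _root_.PercolationContinuityZ3) : IsoShelfNull := by
  obtain ⟨-, -, -, -, -, -, -, -, h9, -⟩ :=
    Summit.CriticalPhenomena.PercolationContinuityZ3.Theorems.ModelFacts.modelFacts_proof
  delta IsoShelfNull ShelfNullBelow
  intro μ vert cfg θ pc
  refine ⟨Summit.CriticalPhenomena.PercolationContinuityZ3.Cruxes.CriticalCurveRegular.Locmod.CriticalCurveRegular_proof, ?_⟩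
  intro t _ _ htp
  have hmono : θ (Literature.Probability.Percolation.criticalProb (Literature.Probability.LatticeModels.zdGraph 3)
      (0 : Literature.Probability.LatticeModels.Site 3)) t ≤
      θ (Literature.Probability.Percolation.criticalProb (Literature.Probability.LatticeModels.zdGraph 3)
      (0 : Literature.Probability.LatticeModels.Site 3))
      (Literature.Probability.Percolation.criticalProb (Literature.Probability.LatticeModels.zdGraph 3)
      (0 : Literature.Probability.LatticeModels.Site 3)) :=
    Summit.CriticalPhenomena.PercolationContinuityZ3.Cruxes.CriticalCurveRegular.Locmod.theta_mono le_rfl htp.le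
  have hdiag : θ (Literature.Probability.Percolation.criticalProb (Literature.Probability.LatticeModels.zdGraph 3)
      (0 : Literature.Probability.LatticeModels.Site 3))
      (Literature.Probability.Percolation.criticalProb (Literature.Probability.LatticeModels.zdGraph 3)
      (0 : Literature.Probability.LatticeModels.Site 3)) = 0 := by
    have e := h9 (Literature.Probability.Percolation.criticalProbI 3)
    exact e.trans hS
  have hnn : 0 ≤ θ (Literature.Probability.Percolation.criticalProb (Literature.Probability.LatticeModels.zdGraph 3)
      (0 : Literature.Probability.LatticeModels.Site 3)) t := MeasureTheory.measureReal_nonneg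
  exact le_antisymm (hmono.trans hdiag.le) hnn

/-- `S → Rung → floor`. -/
theorem rung_between :
    (_root_.PercolationContinuityZ3 → IsoShelfNull) ∧ (IsoShelfNull → CriticalCurveRegular) :=
  ⟨isoShelfNull_of_percolationContinuityZ3, criticalCurveRegular_of_isoShelfNull⟩

end Summit.CriticalPhenomena.PercolationContinuityZ3.Cruxes.SubcritExchangeUniformity.IsoShelf.OnPath
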